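import Literature.AnabelianGeometry.SemiGraphs.TemperedOpenMapping
import Literature.AnabelianGeometry.SemiGraphs.TemperedCompactPreimage
import Literature.AnabelianGeometry.SemiGraphs.TemperedAnabelianThm68Sub
import HarnessLib

/-!
# Decomposition groups in `Π^temp_{X_K}` are compact — `Thm68Sub.DecompCompact` is a theorem

Mochizuki, *Semi-graphs of anabelioids*, Publ. RIMS **42** (2006), §6 p. 71
[cite: MochizukiSemiAnbd2006, §6 p.71]: "`D_x` always surjects onto an open subgroup of `G_K`", and
"`I_x := D_x ∩ Δ^temp_X` is isomorphic to `Ẑ(1)` (respectively, `{1}`) if `x` is (respectively, is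
not) a cusp" — whence, tacitly (e.g. [IUTchI] Cor. 2.5 proof, kurims p. 51: "Since `D_x` is compact
and surjects onto an open subgroup of `G_k` …"), `D_x` is COMPACT.  The §6 interface `TemperedCurve`
(`TemperedAnabelian.lean`) records the two quoted facts (`isOpen_aug_decomp`, `inertia_eq_bot` /
`inertia_equiv_zHat`) and `isClosed_decomp`, but not compactness, which was therefore typed as the
named hypothesis `Thm68Sub.DecompCompact` (`TemperedAnabelianThm68Sub.lean`, T68-B1) and recorded as
GAP-LEDGER row G-L5t11g4-1 ("a closed subgroup injecting continuously into a compact group need not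
be compact").

This proof-only file DERIVES compactness from the interface fields plus "`Π^temp_{X_K}` is tempered
and Galois-countable" (the parameter bundle `TemperedCurve.GroupLevelData`), by the open mapping
theorem for tempered groups (`TemperedOpenMapping.lean`):

* `IsTempered.subgroup_of_isClosed` — a closed subgroup of a tempered group is tempered (Def. 3.1 (i)
  in the tree's complete inverse-limit form: basis / separated / complete all descend);
* `IsTempered.compactSpace_of_isOpenMap_of_isCompact_ker` — a tempered group admitting an OPEN
  continuous surjective homomorphism onto a compact group with compact kernel is compact (every open
  normal subgroup then has finite index; compactness by `IsTempered.isCompact_of_finite_image`);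
* `TemperedCurve.isCompact_decomp_of_isTempered` — for `X : TemperedCurve p` with `Π^temp_{X_K}`
  tempered and first countable, every `D_x` is compact: `aug|_{D_x} : D_x ↠ aug(D_x)` is open by
  `IsTempered.isOpenMap_of_surjective` (target an open, hence compact, subgroup of `G_{ℚ_p}`), with
  kernel `I_x ≅ Ẑ(1)` or `{1}`;
* `TemperedCurve.decompCompact_of_isTempered` / `decompCompact_of_groupLevelData` — the named
  hypothesis `Thm68Sub.DecompCompact X` HOLDS under these parameters (consumers:
  `Thm68Sub.decompRecovered_of_compact`, `finiteIndex_decomp_inf_of_compact`; [IUTchI] Cor. 2.5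
  `StableCurveTemperedData.cor25_byName`, binder `hc`).

Refereed pre-IUT material; nothing here bears on [IUTchIII] Cor. 3.12; typed ≠ discharged.
-/

open Topology Filter Set
open scoped Pointwise

namespace Literature.AnabelianGeometry.SemiGraphs

universe u v

/-! ## Closed subgroups of tempered groups are tempered -/

section ClosedSubgroup

variable {G : Type u} [Group G] [TopologicalSpace G] [IsTopologicalGroup G]

/-- **Closed subgroups of tempered groups are tempered** ([SemiAnbd] Def. 3.1 (i); cf. Ex. 3.10
"Note that `Δ` is also tempered", p. 43): for `G` tempered in the tree's inverse-limit form and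
`D ≤ G` closed, the traces `N ∩ D` of the open normal subgroups of `G` form a basis of open normal
subgroups of `D` of countable index, separate points, and compatible coset families of `D` lift to
compatible coset families of `G`, whose limit lies in the CLOSED subgroup `D`.
[cite: MochizukiSemiAnbd2006, Def 3.1(i) p.33] -/
theorem IsTempered.subgroup_of_isClosed (hG : IsTempered G) (D : Subgroup G)
    (hD : IsClosed (D : Set G)) : IsTempered D := by
  classical
  -- the trace `N ∩ D` of an open normal subgroup `N ≤ G`, an open normal subgroup of `D`
  obtain ⟨tr, mem_tr⟩ : ∃ tr : OpenNormalSubgroup G → OpenNormalSubgroup D,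
      ∀ {N : OpenNormalSubgroup G} {d : D}, d ∈ tr N ↔ (d : G) ∈ N :=
    ⟨fun N =>
      { toOpenSubgroup := N.toOpenSubgroup.comap D.subtype continuous_subtype_val
        isNormal' := Subgroup.normal_comap _ }, Iff.rfl⟩
  have tr_mono : ∀ {N N' : OpenNormalSubgroup G}, N ≤ N' → tr N ≤ tr N' :=
    fun h d hd => mem_tr.2 (h (mem_tr.1 hd))
  refine ⟨fun U hU => ?_, fun d hd => ?_, fun y hy => ?_⟩
  · -- (a) basis
    obtain ⟨u, hu, huU⟩ := (mem_nhds_subtype _ _ _).1 hU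
    obtain ⟨N, hNc, hNu⟩ := hG.basis u (by simpa using hu)
    refine ⟨tr N, ?_, fun d hd => huU (hNu (mem_tr.1 hd))⟩
    -- `D ⧸ (N ∩ D)` injects into the countable `G ⧸ N`
    haveI := hNc
    let φ : D ⧸ (tr N).toSubgroup →* G ⧸ N.toSubgroup :=
      QuotientGroup.map _ _ D.subtype fun d hd => mem_tr.1 hd
    have hφ : Function.Injective φ := by
      rw [injective_iff_map_eq_one]
      intro q hq
      obtain ⟨d, rfl⟩ := QuotientGroup.mk_surjective q
      rw [QuotientGroup.map_mk, QuotientGroup.eq_one_iff] at hq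
      exact (QuotientGroup.eq_one_iff d).2 (mem_tr.2 hq)
    exact hφ.countable
  · -- (b) separated
    have hd' : (d : G) ≠ 1 := fun h => hd (Subtype.ext h)
    obtain ⟨N, hN⟩ := hG.separated _ hd'
    exact ⟨tr N, fun h => hN (mem_tr.1 h)⟩
  · -- (c) complete
    -- representatives of the given cosets of `D`
    have hrep : ∀ M : OpenNormalSubgroup D, ∃ d : D, y M = (d : D ⧸ M.toSubgroup) := fun M => by
      obtain ⟨d, hd⟩ := QuotientGroup.mk_surjective (y M)
      exact ⟨d, hd.symm⟩
    choose r hr using hrep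
    -- the lifted family of cosets of `G` and its limit
    obtain ⟨g, hg⟩ := hG.complete (fun N => (((r (tr N) : D) : G) : G ⧸ N.toSubgroup)) (by
      intro N N' hNN' a ha
      -- `y (N' ∩ D) = r (N ∩ D)` by compatibility of `y`
      have h1 : y (tr N') = ((r (tr N) : D) : D ⧸ (tr N').toSubgroup) :=
        hy _ _ (tr_mono hNN') _ (hr _)
      have h2 : ((r (tr N') : D) : D ⧸ (tr N').toSubgroup) = r (tr N) := by rw [← hr, h1]
      have h3 : ((r (tr N') : D) : G)⁻¹ * (r (tr N) : D) ∈ N' := mem_tr.1 (QuotientGroup.eq.1 h2)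
      have h4 : ((r (tr N) : D) : G)⁻¹ * a ∈ N' := hNN' (QuotientGroup.eq.1 ha)
      refine QuotientGroup.eq.2 ?_
      simpa [mul_assoc] using N'.toSubgroup.mul_mem h3 h4)
    have hg' : ∀ N : OpenNormalSubgroup G, ((r (tr N) : D) : G)⁻¹ * g ∈ N := fun N =>
      QuotientGroup.eq.1 (hg N)
    -- `g ∈ D` since `D` is closed and every neighbourhood of `g` meets `D`
    have hgD : g ∈ D := by
      have hcl : g ∈ closure (D : Set G) := by
        rw [mem_closure_iff_nhds]
        intro t ht
        have ht' : (fun z => g * z) ⁻¹' t ∈ 𝓝 (1 : G) :=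
          (continuous_const_mul g).continuousAt.preimage_mem_nhds (by simpa using ht)
        obtain ⟨N, -, hNt⟩ := hG.basis _ ht'
        refine ⟨(r (tr N) : D), ?_, (r (tr N)).2⟩
        have hmem : g⁻¹ * ((r (tr N) : D) : G) ∈ N := by
          have h := (N : Subgroup G).inv_mem (hg' N)
          rw [mul_inv_rev, inv_inv] at h
          exact h
        simpa using hNt hmem
      rwa [hD.closure_eq] at hcl
    refine ⟨⟨g, hgD⟩, fun M => ?_⟩
    -- `M ⊇ N ∩ D` for some open normal `N ≤ G`
    obtain ⟨u, hu, huM⟩ := (mem_nhds_subtype _ _ _).1 (M.toOpenSubgroup.mem_nhds_one)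
    obtain ⟨N, -, hNu⟩ := hG.basis u (by simpa using hu)
    have hle : tr N ≤ M := fun d hd => huM (hNu (mem_tr.1 hd))
    have hN : y (tr N) = ((⟨g, hgD⟩ : D) : D ⧸ (tr N).toSubgroup) := by
      rw [hr]
      exact QuotientGroup.eq.2 (mem_tr.2 (hg' N))
    exact hy _ _ hle _ hN

end ClosedSubgroup

/-! ## A tempered group that is "compact-by-compact through an open map" is compact -/

section CompactExtension

variable {T : Type u} [Group T] [TopologicalSpace T] [IsTopologicalGroup T]
variable {C : Type v} [Group C] [TopologicalSpace C] [IsTopologicalGroup C] [CompactSpace C]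

/-- In a tempered group `T`, if a continuous surjective OPEN homomorphism `f : T ↠ C` onto a compact
group has compact kernel, then every open normal subgroup `M ≤ T` has finite index:
`[T : M] = [C : f(M)] · [Ker f : Ker f ∩ M]`, both factors finite (`f(M)` open in the compact `C`;
`Ker f ∩ M` open in the compact `Ker f`). [folklore] -/
private theorem finiteIndex_of_isOpenMap_of_isCompact_ker (f : T →* C) (hfo : IsOpenMap f)
    (hfs : Function.Surjective f) (hker : IsCompact (f.ker : Set T)) (M : Subgroup T) [M.Normal]
    (hM : IsOpen (M : Set T)) : M.FiniteIndex := by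
  classical
  -- `f(M)` is open in `C`, hence of finite index
  have h1 : (M.map f).index ≠ 0 := by
    haveI : Finite (C ⧸ M.map f) :=
      Subgroup.quotient_finite_of_isOpen _ (by rw [Subgroup.coe_map]; exact hfo _ hM)
    exact Subgroup.index_ne_zero_of_finite
  -- `Ker f ∩ M` is open in the compact `Ker f`, hence of finite index in it
  have h2 : M.relIndex f.ker ≠ 0 := by
    haveI : CompactSpace f.ker := isCompact_iff_compactSpace.1 hker
    haveI : Finite (f.ker ⧸ M.subgroupOf f.ker) :=
      Subgroup.quotient_finite_of_isOpen _ (hM.preimage continuous_subtype_val)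
    exact Subgroup.index_ne_zero_of_finite
  -- index bookkeeping
  have h3 : (M.map f).index = (M ⊔ f.ker).index := by
    rw [Subgroup.index_map, MonoidHom.range_eq_top.2 hfs, Subgroup.index_top, mul_one]
  have h4 : M.index = M.relIndex f.ker * (M ⊔ f.ker).index := by
    rw [← Subgroup.relIndex_sup_left (K := M) (H := f.ker), Subgroup.relIndex_mul_index le_sup_left]
  refine ⟨?_⟩
  rw [h4, ← h3]
  exact mul_ne_zero h2 h1

/-- **Compact-by-compact through an open map, tempered case**: a tempered group `T` admitting a
continuous surjective OPEN homomorphism onto a compact group with compact kernel is compact — all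
open normal subgroups have finite index (`finiteIndex_of_isOpenMap_of_isCompact_ker`), so `T`, closed
in itself with finite images in all its discrete quotients, is compact by
`IsTempered.isCompact_of_finite_image` (completeness clause of Def. 3.1 (i)).
[cite: MochizukiSemiAnbd2006, Def 3.1(i) p.33] -/
theorem IsTempered.compactSpace_of_isOpenMap_of_isCompact_ker (hT : IsTempered T) (f : T →* C)
    (hfo : IsOpenMap f) (hfs : Function.Surjective f) (hker : IsCompact (f.ker : Set T)) :
    CompactSpace T := by
  classical
  refine ⟨hT.isCompact_of_finite_image isClosed_univ fun U hU => ?_⟩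
  obtain ⟨N, -, hNU⟩ := hT.basis U hU
  refine ⟨N, hNU, ?_⟩
  haveI : N.toSubgroup.FiniteIndex :=
    finiteIndex_of_isOpenMap_of_isCompact_ker f hfo hfs hker N.toSubgroup N.isOpen
  haveI : Finite (T ⧸ N.toSubgroup) := Subgroup.finite_quotient_of_finiteIndex
  exact Set.toFinite _

end CompactExtension

/-! ## [SemiAnbd] §6: decomposition groups `D_x ⊆ Π^temp_{X_K}` are compact -/

namespace TemperedCurve

variable {p : ℕ} [Fact p.Prime]

/-- **`Δ^temp_X` is tempered** whenever `Π^temp_{X_K}` is ([SemiAnbd] Ex. 3.10 p. 43: "Note that `Δ`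
is also tempered") — for the §6 interface, `Δ^temp_X = Ker(Π^temp_{X_K} → G_{ℚ_p})` is a closed
subgroup (`G_{ℚ_p}` is Hausdorff), so `IsTempered.subgroup_of_isClosed` applies; in particular the
parameter field `GroupLevelData.isTempered_ker` is derivable from `GroupLevelData.isTempered`.
[cite: MochizukiSemiAnbd2006, Ex 3.10 p.43] -/
theorem isTempered_deltaTemp_of_isTempered (X : TemperedCurve p) (hX : IsTempered X.PiTemp) :
    IsTempered X.DeltaTemp := by
  haveI : IsGalois ℚ_[p] (AlgebraicClosure ℚ_[p]) := {}
  haveI : T2Space (GQp p) := krullTopology_t2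
  refine hX.subgroup_of_isClosed _ ?_
  change IsClosed ((X.aug : X.PiTemp → GQp p) ⁻¹' {1})
  exact isClosed_singleton.preimage X.aug.continuous

/-- **`D_x` is compact** ([SemiAnbd] §6 p. 71, tacit; [IUTchI] Cor. 2.5 proof p. 51 "Since `D_x` is
compact …"), DERIVED for the §6 interface `X : TemperedCurve p` with `Π^temp_{X_K}` tempered and first
countable: `D_x` is closed (`isClosed_decomp`), hence tempered; `aug|_{D_x} : D_x ↠ aug(D_x)` is a
continuous surjection onto an open (`isOpen_aug_decomp`), hence compact, subgroup of `G_{ℚ_p}`, so it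
is OPEN by the open mapping theorem for tempered groups; its kernel `I_x = D_x ∩ Δ^temp_X` is `{1}` or
`≅ Ẑ(1)` (`inertia_eq_bot` / `inertia_equiv_zHat`), compact either way; compact-by-compact through
an open map is compact. [cite: MochizukiSemiAnbd2006, §6 p.71] -/
theorem isCompact_decomp_of_isTempered (X : TemperedCurve p) (hX : IsTempered X.PiTemp)
    [FirstCountableTopology X.PiTemp] (x : X.Pt) : IsCompact (X.decomp x : Set X.PiTemp) := by
  classical
  haveI : IsGalois ℚ_[p] (AlgebraicClosure ℚ_[p]) := {}
  haveI : T2Space (GQp p) := krullTopology_t2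
  set D : Subgroup X.PiTemp := X.decomp x with hDdef
  -- `D` is tempered
  have hDt : IsTempered D := hX.subgroup_of_isClosed D (X.isClosed_decomp x)
  -- the image `aug(D)`, an open hence compact subgroup of `G_{ℚ_p}`
  set Cx : Subgroup (GQp p) := D.map X.aug.toMonoidHom with hCxdef
  have hCo : IsOpen (Cx : Set (GQp p)) := by
    rw [hCxdef, Subgroup.coe_map]; exact X.isOpen_aug_decomp x
  haveI : CompactSpace Cx :=
    isCompact_iff_compactSpace.1 (Cx.isClosed_of_isOpen hCo).isCompact
  -- the restricted augmentation `D ↠ aug(D)`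
  let f : D →* Cx := X.aug.toMonoidHom.subgroupMap D
  have hfc : Continuous f :=
    continuous_induced_rng.2 (X.aug.continuous.comp continuous_subtype_val)
  have hfs : Function.Surjective f := X.aug.toMonoidHom.subgroupMap_surjective D
  haveI : FirstCountableTopology D := Topology.IsInducing.subtypeVal.firstCountableTopology
  have hfo : IsOpenMap f := hDt.isOpenMap_of_surjective f hfc hfs
  -- its kernel is `I_x = D_x ∩ Δ^temp_X`, compact
  have hmem_ker : ∀ d : D, d ∈ f.ker ↔ X.aug (d : X.PiTemp) = 1 := fun d => by
    rw [MonoidHom.mem_ker, Subtype.ext_iff]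
    exact Iff.rfl
  have hker_eq : (Subtype.val '' (f.ker : Set D)) = ((X.decomp x ⊓ X.aug.toMonoidHom.ker :
      Subgroup X.PiTemp) : Set X.PiTemp) := by
    ext g
    simp only [Set.mem_image, SetLike.mem_coe, Subgroup.mem_inf]
    constructor
    · rintro ⟨d, hd, rfl⟩
      exact ⟨d.2, (hmem_ker d).1 hd⟩
    · rintro ⟨hgD, hg1⟩
      exact ⟨⟨g, hgD⟩, (hmem_ker _).2 hg1, rfl⟩
  have hker : IsCompact (f.ker : Set D) := by
    rw [Subtype.isCompact_iff, hker_eq]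
    by_cases hx : X.IsCusp x
    · obtain ⟨e⟩ := X.inertia_equiv_zHat x hx
      haveI : CompactSpace ↥(X.decomp x ⊓ X.aug.toMonoidHom.ker) :=
        e.toHomeomorph.symm.compactSpace
      exact isCompact_iff_compactSpace.2 this
    · rw [X.inertia_eq_bot x hx]
      simp
  haveI : CompactSpace D := hDt.compactSpace_of_isOpenMap_of_isCompact_ker f hfo hfs hker
  exact isCompact_iff_compactSpace.2 this

/-- **`Thm68Sub.DecompCompact` holds** for `X : TemperedCurve p` with `Π^temp_{X_K}` tempered and
first countable (T68-B1, [SemiAnbd] §6 p. 71, tacit; GAP-LEDGER G-L5t11g4-1).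
[cite: MochizukiSemiAnbd2006, §6 p.71] -/
theorem decompCompact_of_isTempered (X : TemperedCurve p) (hX : IsTempered X.PiTemp)
    [FirstCountableTopology X.PiTemp] : Thm68Sub.DecompCompact X :=
  fun x => X.isCompact_decomp_of_isTempered hX x

/-- **`Thm68Sub.DecompCompact` holds** under the parameter bundle `d : X.GroupLevelData` ("`Π^temp`
tempered, Galois-countable", ruling η′) — no interface field `isCompact_decomp` is needed.
[cite: MochizukiSemiAnbd2006, §6 p.71] -/
theorem decompCompact_of_groupLevelData (X : TemperedCurve p) (d : X.GroupLevelData) :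
    Thm68Sub.DecompCompact X := by
  haveI := d.secondCountableTopology
  exact X.decompCompact_of_isTempered d.isTempered

end TemperedCurve

end Literature.AnabelianGeometry.SemiGraphs
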